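import Mathlib
import HarnessLib
import HarnessLib.Audit
import Summits.Schanuel.Statement

/-!
Route: MisiurewiczAndreOort

CLOSED (retired) 2026-08-15T13:55:56Z by operator:999:2305528 — reason: not-a-thesis: assembly does not conclude the sub-problem Statement — note: D-0027 §2.1 audit (human 2026-08-15: routes that do not decide the summit are removed): the assembly concludes `DAOExp`, not the sub-problem statement; a NEW conforming route may be opened from the same idea (generated `closes : … → _root_.Schanuel`).. The file is kept as the record of this route; refuted decls are indexed as negative knowledge (`ledger negatives`).

# Route MisiurewiczAndreOort — dynamical André–Oort for λe^z — Misiurewicz parameters as Khovanskii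
points over the kernel; family version by counting, point residue = SC

SECTOR ROUTE (card exponential-family-misiurewicz-andre-oort). Write f_λ(z) = λe^z, a_0 = 0, a_{k+1}
= λe^{a_k}; λ ≠ 0 is a
Misiurewicz (post-singularly finite, PSF) parameter iff a_n(λ) = a_m(λ) for some m < n (inlined via
`Function.iterate`; exact type
(n,m) ⟺ a_{n−1} − a_{m−1} ∈ 2πiℤ∖0; the shallow ones are πiℤ∖0). X = DAOExp ("it suffices to show X"
for the sector, not for the
summit): an irreducible plane curve P = 0 with algebraic coefficients that is not a line y = r x (r
∈ ℚ) and not axis-parallel carries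
only FINITELY many pairs (λ, λ') of Misiurewicz parameters. Under Schanuel the same set is EMPTY
(support SchanuelGivesEmptiness:
every such pair is an algebraic dependence inside a ℚ-independent exponential tower), so X is the
André–Oort-shaped family statement
whose point version is a family of Schanuel instances ("is 1 + 2πi a Misiurewicz parameter?"). X →
Schanuel is NOT claimed; the
assembly ends at X (precedent: sector routes DegreeSpectroscopy, HessianFirstBlood).
Lean: `∀ P : MvPolynomial (Fin 2) ℂ, Irreducible P → (∀ m, IsAlgebraic ℚ (P.coeff m)) → (∀ r : ℚ, ¬
(MvPolynomial.X 1 - MvPolynomial.C (r : ℂ) * MvPolynomial.X 0 ∣ P)) → (∀ c : ℂ, ¬ (MvPolynomial.X 0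
- MvPolynomial.C c ∣ P)) → (∀ c : ℂ, ¬ (MvPolynomial.X 1 - MvPolynomial.C c ∣ P)) → Set.Finite {p :
ℂ × ℂ | (p.1 ≠ 0 ∧ ∃ m n : ℕ, m < n ∧ (fun z : ℂ => p.1 * Complex.exp z)^[n] 0 = (fun z : ℂ => p.1 *
Complex.exp z)^[m] 0) ∧ (p.2 ≠ 0 ∧ ∃ m n : ℕ, m < n ∧ (fun z : ℂ => p.2 * Complex.exp z)^[n] 0 =
(fun z : ℂ => p.2 * Complex.exp z)^[m] 0) ∧ MvPolynomial.eval ![p.1, p.2] P = 0}`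

## Assembly
Degree split, provable now: an irreducible P with the three exclusions has totalDegree ≥ 1; if ≥ 2
apply NonlinearCurveFiniteness;
if = 1 then P = αX + βY + γ with α, β ≠ 0 (axis-parallel excluded), a := −α/β and c := −γ/β are
algebraic, (c ≠ 0 ∨ a ∉ ℚ) by the
special-line exclusion, the zero set is {y = ax + c} and LineFiniteness gives finiteness of {λ : λ,
aλ + c Misiurewicz}, whose
image under λ ↦ (λ, aλ + c) is the pair set. SECTOR ROUTE: the chain ends at DAOExp; Schanuel →
(emptiness, hence X) is the support
SchanuelGivesEmptiness; X → Schanuel is not claimed (X is conjecturally vacuous-by-emptiness,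
exactly as André–Oort finiteness is).

Rationale: WHY THIS LINE. Transplant of the dynamical André–Oort template (BakerDemarco2011; GhiocaEtAl2017 for
z^d + c; Ji–Xie arXiv:2302.02583 for curves of
rational maps) to the transcendental family λe^z, whose PSF parameters (LaubnerSchleicherVicol2008
classify them by integer external
addresses; HubbardSchleicherShishikura2009 gives Thurston rigidity; Bergweiler2016 counts them by
modulus) are Khovanskii points over
ker exp = 2πiℤ of unbounded depth — a sub-tree of Kirby's core ecl(∅) on which Schanuel lives
(schanuelConjecture_iff_ecl_empty_holds)
that no existing route or card isolates. Imported: arithmetic dynamics (the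
special-point/special-curve format and the finiteness-vs-
emptiness split), o-minimal counting (PilaWilkie2006, BinyaminiEtAl2026) on INTEGER ADDRESSES via
the window trick a_j = x_j +
i(y_j + 2πb_j), and classical transcendence already PROVED in the tree (transcendental_pi_holds,
transcendental_exp_holds,
linearIndependent_exp_holds, gelfond_schneider_holds) for the unconditional cells. What it does that
prior routes do not: EclCore /
RigidCore localise Schanuel to the core abstractly; this line names an explicit, combinatorially
indexed part of the core with an
independent (dynamical) reason to expect the statements, proves the special-curve list is forced by
SC, and exhibits inside ONE cell
(shallow × height-one on lines) the phenomenon the whole analogy predicts: finiteness provable now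
(≤ 2 points, π-elimination),
emptiness = an open bilinear relation among π, e^c, e^{πia}.

RANKED CRUXES. #0 DAOExp (target) — dynamical André–Oort for the exponential family over ℚ̄ (family
version): for P ∈ ℚ̄[X,Y] irreducible, not associated to Y − rX (r ∈ ℚ), X − c or Y − c, the set of
pairs of Misiurewicz parameters on P = 0 is finite. Special curves = lines through 0 of rational
slope (they carry (πik, πik′)); axis-parallel lines are excluded so that X stays a family statement
(a vertical line x = c, c ∈ ℚ̄, would smuggle in the point statement "c is not Misiurewicz"). (why
it might fail: no Galois orbits: counting gives sparsity only, and off the lattice/size regimes each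
cell reduces to confining many ℚ-independent x with x, e^x algebraic over ℚ(π, e^c) — the trdeg ≥ 2
wall (barrier LargeTranscendenceDegree).) [GhiocaEtAl2017, BakerDemarco2011,
LaubnerSchleicherVicol2008, Kirby2010]
#2 LineFiniteness (crux) — DAO-exp for LINES over ℚ̄, all depths (card C1 restricted to degree 1):
for algebraic a ≠ 0, c with (c ≠ 0 or a ∉ ℚ), only finitely many Misiurewicz λ have aλ + c
Misiurewicz. Contains "up to finitely many exceptions, no two Misiurewicz parameters differ by an
algebraic number" (a = 1) and "irrational algebraic slopes through 0 are not special" (c = 0).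
[deps: HeightOneLines] [difficulty: open-problem] (why it might fail: beyond height one no engine: a
deep pair (λ type (4,1), λ+c type (3,1)) is exp((λ+c)e^c·2πim/λ) = 2πim′/(λ+c) in three integers;
half the sign regimes die by size, the balanced ones are Schanuel-hard pointwise and nothing known
forces finiteness.) [GhiocaEtAl2017, LaubnerSchleicherVicol2008, Bergweiler2016, Waldschmidt2000]
#3 HeightOneLines (crux) — the height-one table on lines (card C3): same lines, both λ and aλ + c of
type n ≤ 3 (λ ∈ πiℤ∖0, or λe^λ ∈ 2πiℤ, or λ(e^λ − 1) ∈ 2πiℤ): finitely many. Cells proved now ride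
as supports (ShallowHeightOneLines: one coordinate in πiℤ, ≤ 2 solutions;
LambertPairsShiftedDiagonal: (3,1)² on y = x + c); the residual cells are (3,·)×(3,·) with a ≠ 1,
e.g. λe^λ = 2πim ∧ (2λ + c)e^{2λ+c} = 2πim′, i.e. explicit exponential-Diophantine equations with λ
quadratic over ℚ(π, e^c). [deps: ShallowHeightOneLines, LambertPairsShiftedDiagonal] [difficulty: L]
(why it might fail: for a ∉ {0,1} the solutions λ_j are algebraic over ℚ(π, e^c) but span no
lattice, so π-elimination fails and finiteness asks to confine ≥ 3 ℚ-independent λ_j with e^{λ_j} in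
a trdeg-2 field — Schneider–Lang over a field of finite type with no known transcendence type.)
[Waldschmidt2000, BakerTNT1975, Gelfond1934, Bergweiler2016]
#4 AddressSparsity (crux) — Pila–Wilkie sparsity (card C2) in the orbit-modulus normalisation: for P
as in the target, every d and ε > 0 there is κ with #{(λ,λ′) on P = 0 : both Misiurewicz of type ≤ d
with all orbit points of modulus ≤ R} ≤ κ R^ε for R ≥ 1. Route to a proof: window trick (a_j = x_j +
i(y_j + 2πb_j), y_j ∈ (−π,π], b_j ∈ ℤ entering polynomially) makes type-(n,m) parameters the integer
points of an ℝ_an,exp-definable set and pairs on P = 0 the integer points of a codimension-2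
definable Y_P; orbit modulus ≤ R bounds address height by R/2π + 1; Pila–Wilkie bounds the
transcendental part by R^ε; the algebraic part is classified by an Ax–Lindemann lemma for twisted
towers (from ax_schanuel_holds) and emptied of integer points by KernelPairs. The universe being
thinned is polynomial in R (addresses of height ≤ R), not Bergweiler's tower-size count by |λ| ≤ r.
[deps: KernelPairs] [difficulty: XL] (why it might fail: the algebraic part of Y_P may contain a
non-special semialgebraic family of twisted towers carrying integer points (an unforeseen functional
identity between iterated exponentials along an algebraic arc of addresses); and the Lean closure
needs o-minimality + Pila–Wilkie, absent from the tree.) [PilaWilkie2006, BinyaminiEtAl2026,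
Pila2022, Ax1971, LaubnerSchleicherVicol2008]
#5 NonlinearCurveFiniteness (crux) — DAO-exp for irreducible curves of degree ≥ 2 over ℚ̄ (no
exclusions needed: such a curve is never special): finitely many pairs of Misiurewicz parameters.
First cells: conics through kernel pairs' neighbourhoods, e.g. (y − 2x)(y − 3x) + 1 = 0, and the
hyperbola xy = 1 (λ′ = 1/λ). [deps: AddressSparsity] [difficulty: open-problem] (why it might fail:
even the shallow × height-one cell is open on curves: μ_k = φ(πik) (φ algebraic, non-linear) with
e^{μ_k} ∈ ℚ̄(π)^alg for many k spans no lattice, so neither π-elimination nor LW applies; only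
size/reality regimes and sparsity survive.) [GhiocaEtAl2017, BakerDemarco2011, PilaWilkie2006,
Waldschmidt2000]
#9 KernelPairs (support) — no two shallow special points on a non-special curve: for P ≠ 0 with
algebraic coefficients and no factor Y − rX (r ∈ ℚ), P(πik, πik′) ≠ 0 for all nonzero integers k, k′
(expand P(πik, πik′) = Σ_d (πi)^d P_d(k,k′); transcendence of π kills every homogeneous part; then Y
− (k′/k)X divides P). The (2,1)×(2,1) (and ×(3,2)-shallow) cell of the target and the arithmetic
input that empties the algebraic part in AddressSparsity. [difficulty: provable-now] [Lindemann1882,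
BakerTNT1975]
#9 ShallowHeightOneLines (support) — shallow × height-one on lines: for algebraic a ≠ 0, c with (c ≠
0 or a ∉ ℚ), only finitely many nonzero integers k make μ_k = a·πik + c a parameter of type n ≤ 3.
Proof found this session (NOTES.md): e^{μ_k} = e^c E^k with E = e^{πia}; a ∈ ℚ, c ≠ 0: zero
solutions by LW in Baker's form after eliminating π against the complex-conjugate equation (refuter
triage-9 addendum on the card); c = 0, a ∉ ℚ: zero by Gelfond–Schneider; a ∉ ℚ, c ≠ 0: three
solutions k_0,k_1,k_2 give E^{k_1−k_0} = R_1(π), E^{k_2−k_0} = R_2(π) with R_j Möbius over ℚ̄, hence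
(R_1^{d_2} − R_2^{d_1})(π) = 0 is an identity of rational functions, contradicted by the pole of R_1
at ic/(ak_1) — so ≤ 2 solutions, while emptiness of this cell is an OPEN bilinear relation among π,
e^c, e^{πia}. [difficulty: provable-now] [BakerTNT1975, Gelfond1934, Lindemann1882, Weierstrass1885]
#9 LambertPairsShiftedDiagonal (support) — the first Lambert cell: for algebraic c ≠ 0 only finitely
many λ have λe^λ ∈ 2πiℤ∖0 and (λ+c)e^{λ+c} ∈ 2πiℤ∖0. Proof: dividing, λ = c m e^c/(m′ − m e^c); c
real forces λ real (impossible); c non-real gives e^c ∉ ℝ (Im c algebraic ≠ πj by transcendence of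
π), so |m′ − m e^c| ≥ |m|·|Im e^c| and |λ| ≤ |c e^c|/|Im e^c| =: B; then |m| ≤ B e^B/2π and |λ| ≥
2πe^{−B} bound m′; λ is determined by (m, m′). Rational approximations cannot reach the non-real
e^c: a size argument, no transcendence beyond π and Hermite–Lindemann (m′ ≠ m e^c). [difficulty:
provable-now] [Lindemann1882, Hermite1873, Bergweiler2016]
#9 SchanuelGivesEmptiness (support) — the point version is a family of Schanuel instances: Schanuel
⇒ for P ≠ 0 with algebraic coefficients and no factor Y − rX (r ∈ ℚ), NO pair of Misiurewicz
parameters lies on P = 0 (in particular, with P = X − c: no Misiurewicz parameter is algebraic; with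
P = Y − X − c: no two differ by an algebraic number; "1 + 2πik is never Misiurewicz"). Proof: S =
tower levels a_1..a_{n−1}, a′_1..a′_{n′−1}; e^{a_j} = a_{j+1}/λ ∈ ℚ(S) (a_n := a_m); pick a ℚ-basis
x ⊆ S of span S; Schanuel gives trdeg ℚ(x) ≥ trdeg ℚ(x, e^x) ≥ |x|, so x is algebraically
independent; P(ℓ(x), ℓ′(x)) = 0 for the linear forms of λ, λ′ forces ℓ′ = rℓ (r ∈ ℚ) and then (Y −
rX) | P. [difficulty: M] [Kirby2010, Ax1971, Lang1966, Waldschmidt2000]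

TWO-LAYER PLAN. Foreseen glued splits (none filed now): AddressSparsity ⇐ TowerDefinability (window
trick, uniform finiteness of fibres) →
TwistedTowerAxLindemann (algebraic part = kernel-linear families, from ax_schanuel_holds) →
AddressSparsity [k = 2 + PW glue as a
cited fact]; HeightOneLines ⇐ DiagonalCells (a = 1, all three type pairs) → RationalSlopeCells →
IrrationalSlopeCells; LineFiniteness
⇐ HeightOneLines → ShallowTimesDeep (one coordinate in πiℤ, other of any depth: lattice elimination
one level up) → DeepTimesDeep.

KILL CRITERIA. No refutation closes the route cheaply: by SchanuelGivesEmptiness (once proved) a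
counterexample to ANY finiteness/sparsity item is an
infinite family of Schanuel counterexamples — close `refuted:<Decl>` and hand the witness to the
summit's negative side (EclCore's
NotSchanuel list). Pivot triggers: (i) the residual HeightOneLines cells are shown EQUIVALENT to
catalogued open problems (four
exponentials, algebraic independence of π and e^c) — then "finiteness is easier than emptiness" is
false beyond the lattice cells and
the route shrinks to AddressSparsity + supports (close `exhausted` with census, or keep dormant as
the sparsity programme); (ii) the
Ax–Lindemann lemma for twisted towers fails (a non-special algebraic family) — restate
AddressSparsity with the enlarged special list.
Mooted/superseded if a DAO statement for λe^z (or for entire transcendental families) is found in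
print — novelty drops to known.

NOT DECOMPOSED YET. The twisted-tower Ax–Lindemann lemma and the definability bookkeeping (children
of AddressSparsity); the card's transseries engine
(E2) — no item until a specific balanced-regime cell demands it; membership of PSF parameters in
ecl(∅) with a certified format
(non-degeneracy of zeros of a_n − a_m, exponential Thurston rigidity
HubbardSchleicherShishikura2009) — true-looking, not load-bearing
for any item as typed; the "no CM points / algebraic multiplier" half of the parameter space
(sibling card exp-family-multiplier-no-
cm-points) — a different special-point notion and a separate thesis; conics and the degree-2 table;
the negative-side census
(certified enumeration of PSF parameters of address height ≤ 50 + LLL) — a kit job any refuter may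
run against LineFiniteness.

CHEAPEST FALSIFIER. (1) Lookup: any arithmetic statement about Misiurewicz parameters of λe^z
(transcendence, DAO, "1 + 2πi") in Devaney / Schleicher /
Rempe surveys or MathOverflow — would regrade novelty, not truth (zbMATH this session: 0 hits for
three phrasings; galaxy pdf: 0;
panama/crabby saturated). (2) Internal: check whether the (3,1)×(3,2) cell on y = x + c with c REAL
algebraic is elementary (λ² +
(c + 2πik′ − 2πime^c)λ − 2πimce^c = 0 ∧ e^λ = 2πim/λ): if every a = 1 cell falls, HeightOneLines'
residue is exactly the a ≠ 1
cells. (3) Numerics (kit, ~1 CPU-h): Newton-enumerate PSF parameters of types ≤ (4,·), addresses ≤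
30, certify, LLL for pairs on
lines/conics of height ≤ 20 — a persistent 10^-40 coincidence off the special lines would be a
numerical Schanuel counterexample.

NUMBERS. Shallow special points πiℤ∖0 (even: type (2,1); odd: type (3,2), since f_λ(−λ) = −λ for e^λ
= −1). Special curves over ℚ̄: y = rx,
r ∈ ℚ∖0 (forced by SC: proved in NOTES/SchanuelGivesEmptiness). ShallowHeightOneLines bound: ≤ 2
points per line (0 if a ∈ ℚ or
c = 0). Bergweiler2016 Thm: #{λ of exact type (k+l, k), 0 < |λ| ≤ r} ~
f_{k+l−1}(r)·f_{k+l−2}(r)^{1/2}/(2π³)^{1/2} (tower growth) —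
hence counting by orbit modulus (address height ≤ R/2π + 1, universe ~ R^{d−1}) in AddressSparsity;
Pila–Wilkie exponent: any ε > 0.
Items at open: 10 (1 target, 4 cruxes, 4 supports, 1 assembly).

DEFINITION REQUESTS. `IsPostsingularlyFinite (l : ℂ) : Prop := l ≠ 0 ∧ ∃ m n, m < n ∧ (fun z => l *
cexp z)^[n] 0 = (fun z => l * cexp z)^[m] 0` and
`orbitModulusLE (l : ℂ) (n : ℕ) (R : ℝ)` toward Literature/Dynamics (filed after open with `--for`
the target); every item is typed
NOW with the predicate inlined, so nothing waits on it. Cite facts wanted later (not now):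
Pila–Wilkie 2006 Thm 1.8 as a named fact
over an ℝ_an,exp-definability predicate; LSV2008 main theorem (addresses ↔ PSF parameters).

Novelty: Searches (2026-08-15): zbMATH "postsingularly finite exponential maps" (3:
HubbardSchleicherShishikura2009, Bergweiler2016 =
arXiv:1511.08440, LaubnerSchleicherVicol2008 — topology/combinatorics/Nevanlinna counting, no
arithmetic); zbMATH "dynamical
André-Oort conjecture" (15: GhiocaEtAl2017, Ji–Xie arXiv:2302.02583, Ghioca–Ye IMRN 2018,
Favre–Gauthier 2022, Ingram 2021 — all
ALGEBRAIC families, PCF = algebraic parameters, height/equidistribution engines); zbMATH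
"Misiurewicz parameters exponential map
arithmetic" (0), "exponential family preperiodic singular value parameters" (0), "Pila-Wilkie
integer points iterated exponential" (0),
"o-minimality complex dynamics" (3: Scanlon arXiv:1010.0482, o-minimal Skolem–Mahler–Lech for
ORBITS, not parameters); `lit frontier
Schanuel --since 2021` (30 rows: unlikely intersections in tori/abelian/Shimura settings, effective
Pila–Wilkie BinyaminiEtAl2026; no
dynamics); `lit bridges Schanuel --cross any` (no dynamics bridge); `lit galaxy search --star all`
"postsingularly finite exponential"
(pdf 0 hits; panama/crabby queue-saturated twice); arXiv/OpenAlex/S2 APIs rate-limited (429) — claim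
searched-but-incomplete on the
web side; the card's own audit (novelty-audit-7, galaxy pdf intelligent 25 rows) found nothing
arithmetic either.
Nearest prior art found: GhiocaEtAl2017 (doi:10.1215/00127094-3673996; DAO for z^d + c: curves with
infinitely many PCF pairs are
fibres or graphs of symmetries) and Ji–Xie arXiv:2302.02583 (DAO for curves of  [refs: 10.1215/00127094-3673996, 1511.08440, 2302.02583, 1010.0482, doi:10.1215/00127094-3673996, HubbardSchleicherShishikura2009, Bergweiler2016, LaubnerSchleicherVicol2008, GhiocaEtAl2017, BinyaminiEtAl2026, PilaWilkie2006]

Barriers (technique_class: dynamical-unlikely-intersections, o-minimal-counting): - technique_class: dynamical-unlikely-intersections, o-minimal-counting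
- Literature.Barriers.Schanuel.AxSchanuelFunctionalNotNumerical: respected and used as designed —
Ax–Schanuel (ax_schanuel_holds) enters only the FUNCTIONAL step (algebraic part of the
address-definable set in AddressSparsity); no item claims a numerical statement from it; the point
version is handed to Schanuel (SchanuelGivesEmptiness), and the unconditional cells use π, HL, LW,
GS, not functional transcendence.
- Literature.Barriers.Schanuel.LargeTranscendenceDegree: it does not evade it; the bet is that
FINITENESS (not emptiness) on lines can be reached by lattice elimination (ShallowHeightOneLines),
size/reality regimes (LambertPairsShiftedDiagonal) and o-minimal sparsity without ever proving trdeg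
≥ 2 for a specific tuple — and the route records honestly (HeightOneLines, NonlinearCurveFiniteness
why-lines) that off those regimes each cell IS a trdeg-2 confinement statement.
- Literature.Barriers.Schanuel.AlgebraicIndependenceOfLogarithms: not in its class — the residual
cells mix π, e^c (c algebraic) and e^{πia}; logarithms of algebraic numbers appear only through
Baker-form LW eliminations already proved in the tree; no item asserts algebraic independence of
logarithms.
- Literature.Barriers.Schanuel.LinearSubgroupMethodLimit: not used — no auxiliary-function /
linear-subgroup argument is proposed; if a prover attacks a residual cell with Schneider's method
over ℚ(π, e^c) the missing transcendence t

History (route lifecycle, newest last):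
- 2026-08-15T13:51:18Z · CLOSED retired — not-a-thesis: assembly does not conclude the sub-problem Statement (operator:999:1257524)
- 2026-08-15T13:55:56Z · CLOSED retired — not-a-thesis: assembly does not conclude the sub-problem Statement (operator:999:2305528)

sub-problem: Schanuel · status: closed(retired) · opened planner-plancard-Schanuel-Schanuel-exponentia-a461e5e6-0 2026-08-15T11:47:12Z · rev 0 · ledger route-Schanuel-MisiurewiczAndreOort
GENERATED by the gate from the ledger (D-0016/17). Provers cite these decls: `theorem foo : Summit.Schanuel.Schanuel.Theses.MisiurewiczAndreOort.<Decl> := …` in Summits/Schanuel/Schanuel/Theorems/<Name>.lean.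
-/

namespace Summit.Schanuel.Schanuel.Theses.MisiurewiczAndreOort

open scoped BigOperators Topology Manifold Classical MeasureTheory ProbabilityTheory Matrix InnerProductSpace ComplexConjugate ContinuousMap
open Filter Set Function TopologicalSpace MeasureTheory

attribute [summit_statement] _root_.Schanuel

open Literature.Periods

/-- item stmt-Schanuel-6475 · target · rank 0 · closed · moot by None · by planner
why it might fail: no Galois orbits: counting gives sparsity only, and off the lattice/size regimes each cell reduces to confining many ℚ-independent x with x, e^x algebraic over ℚ(π, e^c) — the trdeg ≥ 2 wall (barrier LargeTranscendenceDegree).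
sources: GhiocaEtAl2017, BakerDemarco2011, LaubnerSchleicherVicol2008, Kirby2010
[target] dynamical André–Oort for the exponential family over ℚ̄ (family version): for P ∈ ℚ̄[X,Y]
irreducible, not associated to Y − rX (r ∈ ℚ), X − c or Y − c, the set of pairs of Misiurewicz
parameters on P = 0 is finite. Special curves = lines through 0 of rational slope (they carry (πik,
πik′)); axis-parallel lines are excluded so that X stays a family statement (a vertical line x = c,
c ∈ ℚ̄, would smuggle in the point statement "c is not Misiurewicz"). -/
@[route_item "route-Schanuel-MisiurewiczAndreOort"]
def DAOExp : Prop :=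
  ∀ P : MvPolynomial (Fin 2) ℂ, Irreducible P → (∀ m, IsAlgebraic ℚ (P.coeff m)) → (∀ r : ℚ, ¬ (MvPolynomial.X 1 - MvPolynomial.C (r : ℂ) * MvPolynomial.X 0 ∣ P)) → (∀ c : ℂ, ¬ (MvPolynomial.X 0 - MvPolynomial.C c ∣ P)) → (∀ c : ℂ, ¬ (MvPolynomial.X 1 - MvPolynomial.C c ∣ P)) → Set.Finite {p : ℂ × ℂ | (p.1 ≠ 0 ∧ ∃ m n : ℕ, m < n ∧ (fun z : ℂ => p.1 * Complex.exp z)^[n] 0 = (fun z : ℂ => p.1 * Complex.exp z)^[m] 0) ∧ (p.2 ≠ 0 ∧ ∃ m n : ℕ, m < n ∧ (fun z : ℂ => p.2 * Complex.exp z)^[n] 0 = (fun z : ℂ => p.2 * Complex.exp z)^[m] 0) ∧ MvPolynomial.eval ![p.1, p.2] P = 0}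

/-- item stmt-Schanuel-6476 · crux · rank 2 · closed · moot by None · by planner
why it might fail: beyond height one no engine: a deep pair (λ type (4,1), λ+c type (3,1)) is exp((λ+c)e^c·2πim/λ) = 2πim′/(λ+c) in three integers; half the sign regimes die by size, the balanced ones are Schanuel-hard pointwise and nothing known forces finiteness.
sources: GhiocaEtAl2017, LaubnerSchleicherVicol2008, Bergweiler2016, Waldschmidt2000
[crux] DAO-exp for LINES over ℚ̄, all depths (card C1 restricted to degree 1): for algebraic a ≠ 0,
c with (c ≠ 0 or a ∉ ℚ), only finitely many Misiurewicz λ have aλ + c Misiurewicz. Contains "up to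
finitely many exceptions, no two Misiurewicz parameters differ by an algebraic number" (a = 1) and
"irrational algebraic slopes through 0 are not special" (c = 0). [deps: HeightOneLines] [difficulty:
open-problem] -/
@[route_item "route-Schanuel-MisiurewiczAndreOort"]
def LineFiniteness : Prop :=
  ∀ a c : ℂ, IsAlgebraic ℚ a → IsAlgebraic ℚ c → a ≠ 0 → (c ≠ 0 ∨ a ∉ Set.range ((↑) : ℚ → ℂ)) → Set.Finite {l : ℂ | (l ≠ 0 ∧ ∃ m n : ℕ, m < n ∧ (fun z : ℂ => l * Complex.exp z)^[n] 0 = (fun z : ℂ => l * Complex.exp z)^[m] 0) ∧ (a * l + c ≠ 0 ∧ ∃ m n : ℕ, m < n ∧ (fun z : ℂ => (a * l + c) * Complex.exp z)^[n] 0 = (fun z : ℂ => (a * l + c) * Complex.exp z)^[m] 0)}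

/-- item stmt-Schanuel-6477 · crux · rank 3 · closed · moot by None · by planner
why it might fail: for a ∉ {0,1} the solutions λ_j are algebraic over ℚ(π, e^c) but span no lattice, so π-elimination fails and finiteness asks to confine ≥ 3 ℚ-independent λ_j with e^{λ_j} in a trdeg-2 field — Schneider–Lang over a field of finite type with no known transcendence type.
sources: Waldschmidt2000, BakerTNT1975, Gelfond1934, Bergweiler2016
[crux] the height-one table on lines (card C3): same lines, both λ and aλ + c of type n ≤ 3 (λ ∈
πiℤ∖0, or λe^λ ∈ 2πiℤ, or λ(e^λ − 1) ∈ 2πiℤ): finitely many. Cells proved now ride as supports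
(ShallowHeightOneLines: one coordinate in πiℤ, ≤ 2 solutions; LambertPairsShiftedDiagonal: (3,1)² on
y = x + c); the residual cells are (3,·)×(3,·) with a ≠ 1, e.g. λe^λ = 2πim ∧ (2λ + c)e^{2λ+c} =
2πim′, i.e. explicit exponential-Diophantine equations with λ quadratic over ℚ(π, e^c). [deps:
ShallowHeightOneLines, LambertPairsShiftedDiagonal] [difficulty: L] -/
@[route_item "route-Schanuel-MisiurewiczAndreOort"]
def HeightOneLines : Prop :=
  ∀ a c : ℂ, IsAlgebraic ℚ a → IsAlgebraic ℚ c → a ≠ 0 → (c ≠ 0 ∨ a ∉ Set.range ((↑) : ℚ → ℂ)) → Set.Finite {l : ℂ | (l ≠ 0 ∧ ∃ m n : ℕ, m < n ∧ n ≤ 3 ∧ (fun z : ℂ => l * Complex.exp z)^[n] 0 = (fun z : ℂ => l * Complex.exp z)^[m] 0) ∧ (a * l + c ≠ 0 ∧ ∃ m n : ℕ, m < n ∧ n ≤ 3 ∧ (fun z : ℂ => (a * l + c) * Complex.exp z)^[n] 0 = (fun z : ℂ => (a * l + c) * Complex.exp z)^[m] 0)}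

/-- item stmt-Schanuel-6478 · crux · rank 4 · closed · moot by None · by planner
why it might fail: the algebraic part of Y_P may contain a non-special semialgebraic family of twisted towers carrying integer points (an unforeseen functional identity between iterated exponentials along an algebraic arc of addresses); and the Lean closure needs o-minimality + Pila–Wilkie, absent from the tree.
sources: PilaWilkie2006, BinyaminiEtAl2026, Pila2022, Ax1971, LaubnerSchleicherVicol2008
[crux] Pila–Wilkie sparsity (card C2) in the orbit-modulus normalisation: for P as in the target,
every d and ε > 0 there is κ with #{(λ,λ′) on P = 0 : both Misiurewicz of type ≤ d with all orbit
points of modulus ≤ R} ≤ κ R^ε for R ≥ 1. Route to a proof: window trick (a_j = x_j + i(y_j +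
2πb_j), y_j ∈ (−π,π], b_j ∈ ℤ entering polynomially) makes type-(n,m) parameters the integer points
of an ℝ_an,exp-definable set and pairs on P = 0 the integer points of a codimension-2 definable Y_P;
orbit modulus ≤ R bounds address height by R/2π + 1; Pila–Wilkie bounds the transcendental part by
R^ε; the algebraic part is classified by an Ax–Lindemann lemma for twisted towers (from
ax_schanuel_holds) and emptied of integer points by KernelPairs. The universe being thinned is
polynomial in R (addresses of height ≤ R), not Bergweiler's tower-size count by |λ| ≤ r. [deps:
KernelPairs] [difficulty: XL] -/
@[route_item "route-Schanuel-MisiurewiczAndreOort"]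
def AddressSparsity : Prop :=
  ∀ P : MvPolynomial (Fin 2) ℂ, Irreducible P → (∀ m, IsAlgebraic ℚ (P.coeff m)) → (∀ r : ℚ, ¬ (MvPolynomial.X 1 - MvPolynomial.C (r : ℂ) * MvPolynomial.X 0 ∣ P)) → (∀ c : ℂ, ¬ (MvPolynomial.X 0 - MvPolynomial.C c ∣ P)) → (∀ c : ℂ, ¬ (MvPolynomial.X 1 - MvPolynomial.C c ∣ P)) → ∀ d : ℕ, ∀ ε : ℝ, 0 < ε → ∃ κ : ℝ, ∀ R : ℝ, 1 ≤ R → ∃ S : Finset (ℂ × ℂ), (S.card : ℝ) ≤ κ * R ^ ε ∧ ∀ p : ℂ × ℂ, (p.1 ≠ 0 ∧ ∃ m n : ℕ, m < n ∧ n ≤ d ∧ (fun z : ℂ => p.1 * Complex.exp z)^[n] 0 = (fun z : ℂ => p.1 * Complex.exp z)^[m] 0 ∧ ∀ j ≤ n, ‖(fun z : ℂ => p.1 * Complex.exp z)^[j] 0‖ ≤ R) → (p.2 ≠ 0 ∧ ∃ m n : ℕ, m < n ∧ n ≤ d ∧ (fun z : ℂ => p.2 * Complex.exp z)^[n] 0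 = (fun z : ℂ => p.2 * Complex.exp z)^[m] 0 ∧ ∀ j ≤ n, ‖(fun z : ℂ => p.2 * Complex.exp z)^[j] 0‖ ≤ R) → MvPolynomial.eval ![p.1, p.2] P = 0 → p ∈ S

/-- item stmt-Schanuel-6479 · crux · rank 5 · closed · moot by None · by planner
why it might fail: even the shallow × height-one cell is open on curves: μ_k = φ(πik) (φ algebraic, non-linear) with e^{μ_k} ∈ ℚ̄(π)^alg for many k spans no lattice, so neither π-elimination nor LW applies; only size/reality regimes and sparsity survive.
sources: GhiocaEtAl2017, BakerDemarco2011, PilaWilkie2006, Waldschmidt2000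
[crux] DAO-exp for irreducible curves of degree ≥ 2 over ℚ̄ (no exclusions needed: such a curve is
never special): finitely many pairs of Misiurewicz parameters. First cells: conics through kernel
pairs' neighbourhoods, e.g. (y − 2x)(y − 3x) + 1 = 0, and the hyperbola xy = 1 (λ′ = 1/λ). [deps:
AddressSparsity] [difficulty: open-problem] -/
@[route_item "route-Schanuel-MisiurewiczAndreOort"]
def NonlinearCurveFiniteness : Prop :=
  ∀ P : MvPolynomial (Fin 2) ℂ, Irreducible P → (∀ m, IsAlgebraic ℚ (P.coeff m)) → 2 ≤ P.totalDegree → Set.Finite {p : ℂ × ℂ | (p.1 ≠ 0 ∧ ∃ m n : ℕ, m < n ∧ (fun z : ℂ => p.1 * Complex.exp z)^[n] 0 = (fun z : ℂ => p.1 * Complex.exp z)^[m] 0) ∧ (p.2 ≠ 0 ∧ ∃ m n : ℕ, m < n ∧ (fun z : ℂ => p.2 * Complex.exp z)^[n] 0 = (fun z : ℂ => p.2 * Complex.exp z)^[m] 0) ∧ MvPolynomial.eval ![p.1, p.2] P = 0}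

/-- item stmt-Schanuel-6480 · support · rank 9 · closed · moot by None · by planner
sources: Lindemann1882, BakerTNT1975
[support] no two shallow special points on a non-special curve: for P ≠ 0 with algebraic
coefficients and no factor Y − rX (r ∈ ℚ), P(πik, πik′) ≠ 0 for all nonzero integers k, k′ (expand
P(πik, πik′) = Σ_d (πi)^d P_d(k,k′); transcendence of π kills every homogeneous part; then Y −
(k′/k)X divides P). The (2,1)×(2,1) (and ×(3,2)-shallow) cell of the target and the arithmetic input
that empties the algebraic part in AddressSparsity. [difficulty: provable-now] -/
@[route_item "route-Schanuel-MisiurewiczAndreOort"]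
def KernelPairs : Prop :=
  ∀ P : MvPolynomial (Fin 2) ℂ, P ≠ 0 → (∀ m, IsAlgebraic ℚ (P.coeff m)) → (∀ r : ℚ, ¬ (MvPolynomial.X 1 - MvPolynomial.C (r : ℂ) * MvPolynomial.X 0 ∣ P)) → ∀ k k' : ℤ, k ≠ 0 → k' ≠ 0 → MvPolynomial.eval ![(Real.pi : ℂ) * Complex.I * k, (Real.pi : ℂ) * Complex.I * k'] P ≠ 0

/-- item stmt-Schanuel-6481 · support · rank 9 · closed · moot by None · by planner
sources: BakerTNT1975, Gelfond1934, Lindemann1882, Weierstrass1885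
[support] shallow × height-one on lines: for algebraic a ≠ 0, c with (c ≠ 0 or a ∉ ℚ), only finitely
many nonzero integers k make μ_k = a·πik + c a parameter of type n ≤ 3. Proof found this session
(NOTES.md): e^{μ_k} = e^c E^k with E = e^{πia}; a ∈ ℚ, c ≠ 0: zero solutions by LW in Baker's form
after eliminating π against the complex-conjugate equation (refuter triage-9 addendum on the card);
c = 0, a ∉ ℚ: zero by Gelfond–Schneider; a ∉ ℚ, c ≠ 0: three solutions k_0,k_1,k_2 give E^{k_1−k_0}
= R_1(π), E^{k_2−k_0} = R_2(π) with R_j Möbius over ℚ̄, hence (R_1^{d_2} − R_2^{d_1})(π) = 0 is an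
identity of rational functions, contradicted by the pole of R_1 at ic/(ak_1) — so ≤ 2 solutions,
while emptiness of this cell is an OPEN bilinear relation among π, e^c, e^{πia}. [difficulty:
provable-now] -/
@[route_item "route-Schanuel-MisiurewiczAndreOort"]
def ShallowHeightOneLines : Prop :=
  ∀ a c : ℂ, IsAlgebraic ℚ a → IsAlgebraic ℚ c → a ≠ 0 → (c ≠ 0 ∨ a ∉ Set.range ((↑) : ℚ → ℂ)) → Set.Finite {k : ℤ | k ≠ 0 ∧ a * ((Real.pi : ℂ) * Complex.I * k) + c ≠ 0 ∧ ∃ m n : ℕ, m < n ∧ n ≤ 3 ∧ (fun z : ℂ => (a * ((Real.pi : ℂ) * Complex.I * k) + c) * Complex.exp z)^[n] 0 = (fun z : ℂ => (a * ((Real.pi : ℂ) * Complex.I * k) + c) * Complex.exp z)^[m] 0}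

/-- item stmt-Schanuel-6482 · support · rank 9 · closed · moot by None · by planner
sources: Lindemann1882, Hermite1873, Bergweiler2016
[support] the first Lambert cell: for algebraic c ≠ 0 only finitely many λ have λe^λ ∈ 2πiℤ∖0 and
(λ+c)e^{λ+c} ∈ 2πiℤ∖0. Proof: dividing, λ = c m e^c/(m′ − m e^c); c real forces λ real (impossible);
c non-real gives e^c ∉ ℝ (Im c algebraic ≠ πj by transcendence of π), so |m′ − m e^c| ≥ |m|·|Im e^c|
and |λ| ≤ |c e^c|/|Im e^c| =: B; then |m| ≤ B e^B/2π and |λ| ≥ 2πe^{−B} bound m′; λ is determined by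
(m, m′). Rational approximations cannot reach the non-real e^c: a size argument, no transcendence
beyond π and Hermite–Lindemann (m′ ≠ m e^c). [difficulty: provable-now] -/
@[route_item "route-Schanuel-MisiurewiczAndreOort"]
def LambertPairsShiftedDiagonal : Prop :=
  ∀ c : ℂ, IsAlgebraic ℚ c → c ≠ 0 → Set.Finite {l : ℂ | (∃ m : ℤ, m ≠ 0 ∧ l * Complex.exp l = 2 * (Real.pi : ℂ) * Complex.I * m) ∧ (∃ m : ℤ, m ≠ 0 ∧ (l + c) * Complex.exp (l + c) = 2 * (Real.pi : ℂ) * Complex.I * m)}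

/-- item stmt-Schanuel-6483 · support · rank 9 · closed · moot by None · by planner
sources: Kirby2010, Ax1971, Lang1966, Waldschmidt2000
[support] the point version is a family of Schanuel instances: Schanuel ⇒ for P ≠ 0 with algebraic
coefficients and no factor Y − rX (r ∈ ℚ), NO pair of Misiurewicz parameters lies on P = 0 (in
particular, with P = X − c: no Misiurewicz parameter is algebraic; with P = Y − X − c: no two differ
by an algebraic number; "1 + 2πik is never Misiurewicz"). Proof: S = tower levels a_1..a_{n−1},
a′_1..a′_{n′−1}; e^{a_j} = a_{j+1}/λ ∈ ℚ(S) (a_n := a_m); pick a ℚ-basis x ⊆ S of span S; Schanuel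
gives trdeg ℚ(x) ≥ trdeg ℚ(x, e^x) ≥ |x|, so x is algebraically independent; P(ℓ(x), ℓ′(x)) = 0 for
the linear forms of λ, λ′ forces ℓ′ = rℓ (r ∈ ℚ) and then (Y − rX) | P. [difficulty: M] -/
@[route_item "route-Schanuel-MisiurewiczAndreOort"]
def SchanuelGivesEmptiness : Prop :=
  _root_.Schanuel → ∀ P : MvPolynomial (Fin 2) ℂ, P ≠ 0 → (∀ m, IsAlgebraic ℚ (P.coeff m)) → (∀ r : ℚ, ¬ (MvPolynomial.X 1 - MvPolynomial.C (r : ℂ) * MvPolynomial.X 0 ∣ P)) → ∀ l l' : ℂ, (l ≠ 0 ∧ ∃ m n : ℕ, m < n ∧ (fun z : ℂ => l * Complex.exp z)^[n] 0 = (fun z : ℂ => l * Complex.exp z)^[m] 0) → (l' ≠ 0 ∧ ∃ m n : ℕ, m < n ∧ (fun z : ℂ => l' * Complex.exp z)^[n] 0 = (fun z : ℂ => l' * Complex.exp z)^[m] 0) → MvPolynomial.eval ![l, l'] P ≠ 0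

/-- item stmt-Schanuel-6484 · assembly · rank 1 · closed · moot by None · by planner
sources: GhiocaEtAl2017
[assembly] LineFiniteness → NonlinearCurveFiniteness → DAOExp (degree split of an irreducible plane
curve; MvPolynomial bookkeeping). -/
@[route_item "route-Schanuel-MisiurewiczAndreOort"]
def Assembly : Prop :=
  LineFiniteness → NonlinearCurveFiniteness → DAOExp

end Summit.Schanuel.Schanuel.Theses.MisiurewiczAndreOort
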